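import Mathlib.MeasureTheory.Measure.Lebesgue.EqHaar
import Mathlib.MeasureTheory.Measure.Haar.InnerProductSpace
import HarnessLib

/-!
# Stub `stub_locality` of line `Sketch` (crux `OSLegsAtWeakCouplingC`, stmt-QuantumFields-16207) — helper:
# the exceptional set of coordinate coincidences is closed and Lebesgue-null

Helper file for stub `stub_locality`.  In the locality step the rotation defect of an `m`-point Schwinger
function is shown to vanish locally near every configuration `c : Fin m → ℝ⁴` whose coordinates are pairwise
distinct along every axis, both for `c` and for the rotated configuration `R ∘ c`
(`R : ℝ⁴ ≃ₗᵢ[ℝ] ℝ⁴`).  The complement of these good configurations,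

`N = {c | ∃ i ≠ j, ∃ μ, c i μ = c j μ ∨ (R (c i)) μ = (R (c j)) μ}`,

must be closed and of Lebesgue measure zero so that the tree's null-set closure lemma
(`eq_zero_of_null_exceptional`, which needs exactly `IsClosed N` and `volume N = 0`) applies.  This file proves
that (`isClosed_null_coordCoincidence`, registered signature): `N` is the finite union over `(i, j, μ)`, `i ≠ j`,
of the zero sets of the continuous nonzero linear functionals `c ↦ (T (c i)) μ − (T (c j)) μ` (`T = 1` or
`T = R`) on the real vector space `Fin m → ℝ⁴`; each is a closed proper subspace, hence null for the additive
Haar measure `volume` (`MeasureTheory.Measure.addHaar_submodule`), and finite unions preserve both properties.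

Elementary (folklore) linear algebra / measure theory; Mathlib only, no new definitions.
-/

noncomputable section

open MeasureTheory

namespace Summit.QuantumFields.YangMills.Theorems.OSLegsAtWeakCouplingC

/-- **Zero set of a nonzero functional.**  For a continuous linear functional `ℓ` on a finite-dimensional real
normed space with `ℓ x₀ ≠ 0` for some `x₀`, the hyperplane `{x | ℓ x = 0}` is closed and null for every additive
Haar measure (it is the proper closed submodule `ker ℓ`; `Measure.addHaar_submodule`). [folklore] -/
theorem isClosed_and_null_setOf_apply_eq_zero {E : Type*} [NormedAddCommGroup E] [NormedSpace ℝ E]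
    [MeasurableSpace E] [BorelSpace E] [FiniteDimensional ℝ E] (ν : Measure E) [ν.IsAddHaarMeasure]
    (ℓ : E →L[ℝ] ℝ) {x₀ : E} (hx₀ : ℓ x₀ ≠ 0) :
    IsClosed {x : E | ℓ x = 0} ∧ ν {x : E | ℓ x = 0} = 0 := by
  refine ⟨isClosed_eq ℓ.continuous continuous_const, ?_⟩
  have hker : ({x : E | ℓ x = 0} : Set E) = (LinearMap.ker (ℓ : E →ₗ[ℝ] ℝ) : Set E) := by
    ext x
    simp
  rw [hker]
  refine Measure.addHaar_submodule ν _ (fun htop => hx₀ ?_)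
  have hx : x₀ ∈ LinearMap.ker (ℓ : E →ₗ[ℝ] ℝ) := htop ▸ Submodule.mem_top
  simpa using hx

/-- **One coincidence hyperplane.**  For a continuous linear automorphism `T` of `ℝ⁴`, indices `i ≠ j` in
`Fin m` and an axis `μ`, the set of configurations `c : Fin m → ℝ⁴` with `(T (c i)) μ = (T (c j)) μ` is closed
and Lebesgue-null: it is the zero set of the continuous functional `c ↦ (T (c i − c j)) μ`, which does not
vanish at `c = Pi.single i (T⁻¹ e_μ)`. [folklore] -/
theorem isClosed_and_null_coordEq {m : ℕ}
    (T : EuclideanSpace ℝ (Fin 4) ≃L[ℝ] EuclideanSpace ℝ (Fin 4)) {i j : Fin m} (hij : i ≠ j) (μ : Fin 4) :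
    IsClosed {c : Fin m → EuclideanSpace ℝ (Fin 4) | T (c i) μ = T (c j) μ} ∧
      volume {c : Fin m → EuclideanSpace ℝ (Fin 4) | T (c i) μ = T (c j) μ} = 0 := by
  let ℓ : (Fin m → EuclideanSpace ℝ (Fin 4)) →L[ℝ] ℝ :=
    (EuclideanSpace.proj μ).comp
      ((T : EuclideanSpace ℝ (Fin 4) →L[ℝ] EuclideanSpace ℝ (Fin 4)).comp
        (ContinuousLinearMap.proj (R := ℝ) (φ := fun _ : Fin m => EuclideanSpace ℝ (Fin 4)) i -
          ContinuousLinearMap.proj (R := ℝ) (φ := fun _ : Fin m => EuclideanSpace ℝ (Fin 4)) j))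
  have hℓ : ∀ c : Fin m → EuclideanSpace ℝ (Fin 4), ℓ c = T (c i) μ - T (c j) μ := by
    intro c
    simp [ℓ]
  have hset : {c : Fin m → EuclideanSpace ℝ (Fin 4) | T (c i) μ = T (c j) μ} =
      {c : Fin m → EuclideanSpace ℝ (Fin 4) | ℓ c = 0} := by
    ext c
    simp only [Set.mem_setOf_eq, hℓ, sub_eq_zero]
  rw [hset]
  refine isClosed_and_null_setOf_apply_eq_zero volume ℓ
    (x₀ := Pi.single i (T.symm (EuclideanSpace.single μ 1))) ?_
  rw [hℓ]
  simp [Pi.single_eq_of_ne hij.symm]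

/-- **The exceptional set of coordinate coincidences is closed and null** (registered helper of
`stub_locality`).  For `m : ℕ` and a linear isometry `R` of `ℝ⁴`, the set of configurations
`c : Fin m → ℝ⁴` having two distinct points `c i`, `c j` which share a coordinate, or whose images `R (c i)`,
`R (c j)` share a coordinate, is closed and has Lebesgue (product) measure zero: it is a finite union of the
coincidence hyperplanes of `isClosed_and_null_coordEq` (with `T = 1` and `T = R`). [folklore] -/
theorem isClosed_null_coordCoincidence : ∀ (m : ℕ) (R : EuclideanSpace ℝ (Fin 4) ≃ₗᵢ[ℝ] EuclideanSpace ℝ (Fin 4)), IsClosed {c : Fin m → EuclideanSpace ℝ (Fin 4) | ∃ i j : Fin m, i ≠ j ∧ ∃ μ : Fin 4, c i μ = c j μ ∨ R (c i) μ = R (c j) μ} ∧ MeasureTheory.volume {c : Fin m → EuclideanSpace ℝ (Fin 4) | ∃ i j : Fin m, i ≠ j ∧ ∃ μ : Fin 4, c i μ = c j μ ∨ R (c i) μ = R (c j) μ} = 0 := by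
  intro m R
  -- the two families of coincidence hyperplanes
  have hA : ∀ i j : Fin m, i ≠ j → ∀ μ : Fin 4,
      IsClosed {c : Fin m → EuclideanSpace ℝ (Fin 4) | c i μ = c j μ} ∧
        volume {c : Fin m → EuclideanSpace ℝ (Fin 4) | c i μ = c j μ} = 0 := by
    intro i j hij μ
    simpa using isClosed_and_null_coordEq (ContinuousLinearEquiv.refl ℝ _) hij μ
  have hB : ∀ i j : Fin m, i ≠ j → ∀ μ : Fin 4,
      IsClosed {c : Fin m → EuclideanSpace ℝ (Fin 4) | R (c i) μ = R (c j) μ} ∧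
        volume {c : Fin m → EuclideanSpace ℝ (Fin 4) | R (c i) μ = R (c j) μ} = 0 := by
    intro i j hij μ
    simpa using isClosed_and_null_coordEq R.toContinuousLinearEquiv hij μ
  -- each piece of the finite union (empty when `i = j`)
  have hpiece : ∀ (i j : Fin m) (μ : Fin 4),
      IsClosed {c : Fin m → EuclideanSpace ℝ (Fin 4) | i ≠ j ∧ (c i μ = c j μ ∨ R (c i) μ = R (c j) μ)} ∧
        volume {c : Fin m → EuclideanSpace ℝ (Fin 4) | i ≠ j ∧ (c i μ = c j μ ∨ R (c i) μ = R (c j) μ)}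
          = 0 := by
    intro i j μ
    by_cases hij : i = j
    · simp [hij]
    · have hunion : {c : Fin m → EuclideanSpace ℝ (Fin 4) | i ≠ j ∧ (c i μ = c j μ ∨ R (c i) μ = R (c j) μ)}
          = {c | c i μ = c j μ} ∪ {c | R (c i) μ = R (c j) μ} := by
        ext c
        simp [hij]
      rw [hunion]
      exact ⟨(hA i j hij μ).1.union (hB i j hij μ).1, measure_union_null (hA i j hij μ).2 (hB i j hij μ).2⟩
  -- the exceptional set is the finite union of the pieces
  set S := {c : Fin m → EuclideanSpace ℝ (Fin 4) | ∃ i j : Fin m, i ≠ j ∧ ∃ μ : Fin 4,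
    c i μ = c j μ ∨ R (c i) μ = R (c j) μ} with hS_def
  have hS : S = ⋃ i : Fin m, ⋃ j : Fin m, ⋃ μ : Fin 4,
      {c : Fin m → EuclideanSpace ℝ (Fin 4) | i ≠ j ∧ (c i μ = c j μ ∨ R (c i) μ = R (c j) μ)} := by
    ext c
    simp only [hS_def, Set.mem_setOf_eq, Set.mem_iUnion]
    constructor
    · rintro ⟨i, j, hij, μ, h⟩
      exact ⟨i, j, μ, hij, h⟩
    · rintro ⟨i, j, μ, hij, h⟩
      exact ⟨i, j, hij, μ, h⟩
  rw [hS]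
  exact ⟨isClosed_iUnion_of_finite fun i => isClosed_iUnion_of_finite fun j =>
      isClosed_iUnion_of_finite fun μ => (hpiece i j μ).1,
    measure_iUnion_null fun i => measure_iUnion_null fun j =>
      measure_iUnion_null fun μ => (hpiece i j μ).2⟩

end Summit.QuantumFields.YangMills.Theorems.OSLegsAtWeakCouplingC

end
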